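import Summits.BirchSwinnertonDyer.BirchSwinnertonDyer.Theorems.ManinLocalTwoThreeEtaIdentityKFiftySix
import Summits.BirchSwinnertonDyer.BirchSwinnertonDyer.Theorems.ManinLocalTwoThreeNewformPinningFiftySix
import Summits.BirchSwinnertonDyer.BirchSwinnertonDyer.Theorems.ManinLocalTwoThreeNeronSqueeze
import Summits.BirchSwinnertonDyer.Rank1Residual.Additive.IntModelConductorCertificate
import HarnessLib

/-!
# Level 56: `|c| = 1` — hence `2 ∤ c` — for EVERY lattice-optimal `X₀(56)`-datum of EVERY globally minimal elliptic curve over `ℚ`,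
# unconditionally (genus `5`, TWO newforms)

Cell bsd-f2-manin, route `ManinLocalTwoThree` (crux C2 `ManinOddAtFour`, stmt-22967: `2² ∣ 56`), prover seat p2 gen 28.  CAPSTONE of the
level-`56` programme: `NewformPinningFiftySix` (`D.f = P − Q ∨ D.f = P + Q`, fact-free, planner-an g51's turnkey),
`EtaIdentitiesFiftySix` ((S2)₅₆ₐ `Λ(P − Q) ⊆ Λ(−4, −8)`), `EtaIdentityKFiftySix` ((S2)₅₆_b `Λ(P + Q) ⊆ Λ(4/3, 440/27)`), both through the
ATKIN–LEHNER `η`-PERMUTATION device at the cusp `1/8` (`AtkinLehnerEtaFiftySix`), and p3's general `NeronSqueeze`.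

* §1 the two globally minimal models `56a1 = [0, 0, 0, 1, 2]` (`c₄ = −48`, `c₆ = −1728`, `Δ = −2⁸·7`) and `56b1 = [0, −1, 0, 0, −4]`
  (`c₄ = 16`, `c₆ = 3520`, `Δ = −2¹⁰·7`): kernel minimality certificates, their Néron invariants `(g₂, g₃) = (c₄/12, c₆/216) = (−4, −8)`,
  `(4/3, 440/27)`;
* §2 **THE NÉRON SQUEEZE at `56`**: for every globally minimal elliptic `W/ℚ` and every `X₀(56)`-datum `D` with the lattice clause
  `Λ_W = c·Λ(D.f)`: `|c| = 1` (`abs_maninConstant_eq_one_fiftySix`) — branch `56a` squeezed against `[0,0,0,1,2]`, branch `56b` against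
  `[0,−1,0,0,−4]`; hence **`2 ∤ c`** — C2's conclusion on the whole `X₀(56)`-domain (`maninOddAtFour_fiftySix`).

HONEST FRAMING: unconditional (axioms `propext`, `Classical.choice`, `Quot.sound`); Manin's conjecture at ONE additive level.  Nothing here
proves C2 for all `N`, Manin's conjecture, or BSD; the items stay OPEN as filed (⟸ CDT).  [cite: CremonaAlgorithms1997, Table 1 (56a1, 56b1), §2.10]
[cite: SilvermanAEC2009, VII.1 Remark 1.1] [cite: AgasheRibetStein2006, §§1–2]
-/

set_option autoImplicit false
-- lint-debt: the directory name repeats the summit name (sibling precedent `ManinLocalTwoThreeEtaIdentitiesForty.lean`)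
set_option linter.dupNamespace false

noncomputable section

open Complex Filter Topology Set
open UpperHalfPlane hiding I
open scoped Real Topology Manifold MatrixGroups ModularForm
open ModularForm CongruenceSubgroup WeierstrassCurve
open Summit.BirchSwinnertonDyer.Rank1Residual.Additive
open Literature.NumberTheory.EllipticCurves Literature.NumberTheory.EllipticCurves.ModularForms

namespace Summit.BirchSwinnertonDyer.BirchSwinnertonDyer.Theorems.ManinLocalTwoThree.ManinConstantFiftySix

open NewformsFiftySix NewformPinningFiftySix EtaIdentitiesFiftySix EtaIdentityKFiftySix

/-! ## §1 The globally minimal models `56a1`, `56b1` and their Néron invariants -/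

/-- The literal `ℚ`-model `[0, 0, 0, 1, 2]` read through integer casts. [folklore] -/
theorem mk_fiftySixA1_eq_cast :
    (⟨0, 0, 0, 1, 2⟩ : WeierstrassCurve ℚ) = ⟨((0 : ℤ) : ℚ), ((0 : ℤ) : ℚ), ((0 : ℤ) : ℚ), ((1 : ℤ) : ℚ), ((2 : ℤ) : ℚ)⟩ := by
  ext <;> norm_num

/-- The literal `ℚ`-model `[0, −1, 0, 0, −4]` read through integer casts. [folklore] -/
theorem mk_fiftySixB1_eq_cast :
    (⟨0, -1, 0, 0, -4⟩ : WeierstrassCurve ℚ) = ⟨((0 : ℤ) : ℚ), ((-1 : ℤ) : ℚ), ((0 : ℤ) : ℚ), ((0 : ℤ) : ℚ), ((-4 : ℤ) : ℚ)⟩ := by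
  ext <;> norm_num

/-- `56a1 = [0, 0, 0, 1, 2]` is globally minimal (`Δ = −2⁸·7`, `v₂(Δ) = 8 < 12`, `7 ∤ c₄ = −48`; kernel certificate).
[cite: SilvermanAEC2009, VII.1 Remark 1.1] -/
theorem isGloballyMinimal_fiftySixA1 : (⟨0, 0, 0, 1, 2⟩ : WeierstrassCurve ℚ).IsGloballyMinimal := by
  rw [mk_fiftySixA1_eq_cast]
  exact IntModelCond.isGloballyMinimal_mk_of_minCheck 0 0 0 1 2 (cm := ⟨8, 4, 6, [⟨7, 2, 1, 0, 0⟩]⟩) (by decide +kernel)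

/-- `56b1 = [0, −1, 0, 0, −4]` is globally minimal (`Δ = −2¹⁰·7`, `v₂(Δ) = 10 < 12`, `7 ∤ c₄ = 16`; kernel certificate).
[cite: SilvermanAEC2009, VII.1 Remark 1.1] -/
theorem isGloballyMinimal_fiftySixB1 : (⟨0, -1, 0, 0, -4⟩ : WeierstrassCurve ℚ).IsGloballyMinimal := by
  rw [mk_fiftySixB1_eq_cast]
  exact IntModelCond.isGloballyMinimal_mk_of_minCheck 0 (-1) 0 0 (-4) (cm := ⟨10, 4, 6, [⟨7, 2, 1, 0, 0⟩]⟩) (by decide +kernel)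

/-- `[0, 0, 0, 1, 2]` is an elliptic curve (`Δ = −1792 ≠ 0`); a theorem, use `haveI`. [folklore] -/
theorem isElliptic_fiftySixA1 : (⟨0, 0, 0, 1, 2⟩ : WeierstrassCurve ℚ).IsElliptic :=
  ⟨by norm_num [WeierstrassCurve.Δ, WeierstrassCurve.b₂, WeierstrassCurve.b₄, WeierstrassCurve.b₆, WeierstrassCurve.b₈]⟩

/-- `[0, −1, 0, 0, −4]` is an elliptic curve (`Δ = −7168 ≠ 0`); a theorem, use `haveI`. [folklore] -/
theorem isElliptic_fiftySixB1 : (⟨0, -1, 0, 0, -4⟩ : WeierstrassCurve ℚ).IsElliptic :=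
  ⟨by norm_num [WeierstrassCurve.Δ, WeierstrassCurve.b₂, WeierstrassCurve.b₄, WeierstrassCurve.b₆, WeierstrassCurve.b₈]⟩

/-- **The Néron invariants of `56a1`**: `c₄ = −48`, `c₆ = −1728`, so `IsNeronLatticeOf (W₀/ℂ) L ⟺ (g₂(L), g₃(L)) = (−4, −8)`.
[cite: CremonaAlgorithms1997, Table 1 (56a1)] -/
theorem isNeronLatticeOf_fiftySixA1_iff (L : PeriodPair) :
    IsNeronLatticeOf ((⟨0, 0, 0, 1, 2⟩ : WeierstrassCurve ℚ).baseChange ℂ) L ↔ L.g₂ = -4 ∧ L.g₃ = -8 := by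
  have h4 : ((⟨0, 0, 0, 1, 2⟩ : WeierstrassCurve ℚ).baseChange ℂ).c₄ = (((⟨0, 0, 0, 1, 2⟩ : WeierstrassCurve ℚ).c₄ : ℚ) : ℂ) := by
    simp [WeierstrassCurve.baseChange, WeierstrassCurve.map_c₄]
  have h6 : ((⟨0, 0, 0, 1, 2⟩ : WeierstrassCurve ℚ).baseChange ℂ).c₆ = (((⟨0, 0, 0, 1, 2⟩ : WeierstrassCurve ℚ).c₆ : ℚ) : ℂ) := by
    simp [WeierstrassCurve.baseChange, WeierstrassCurve.map_c₆]
  have h4' : (⟨0, 0, 0, 1, 2⟩ : WeierstrassCurve ℚ).c₄ = -48 := by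
    norm_num [WeierstrassCurve.c₄, WeierstrassCurve.b₂, WeierstrassCurve.b₄]
  have h6' : (⟨0, 0, 0, 1, 2⟩ : WeierstrassCurve ℚ).c₆ = -1728 := by
    norm_num [WeierstrassCurve.c₆, WeierstrassCurve.b₂, WeierstrassCurve.b₄, WeierstrassCurve.b₆]
  rw [IsNeronLatticeOf, h4, h6, h4', h6']
  push_cast
  constructor
  · rintro ⟨ha, hb⟩; exact ⟨by rw [ha]; norm_num, by rw [hb]; norm_num⟩
  · rintro ⟨ha, hb⟩; exact ⟨by rw [ha]; norm_num, by rw [hb]; norm_num⟩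

/-- **The Néron invariants of `56b1`**: `c₄ = 16`, `c₆ = 3520`, so `IsNeronLatticeOf (W₀/ℂ) L ⟺ (g₂(L), g₃(L)) = (4/3, 440/27)`.
[cite: CremonaAlgorithms1997, Table 1 (56b1)] -/
theorem isNeronLatticeOf_fiftySixB1_iff (L : PeriodPair) :
    IsNeronLatticeOf ((⟨0, -1, 0, 0, -4⟩ : WeierstrassCurve ℚ).baseChange ℂ) L ↔ L.g₂ = 4 / 3 ∧ L.g₃ = 440 / 27 := by
  have h4 : ((⟨0, -1, 0, 0, -4⟩ : WeierstrassCurve ℚ).baseChange ℂ).c₄ = (((⟨0, -1, 0, 0, -4⟩ : WeierstrassCurve ℚ).c₄ : ℚ) : ℂ) := by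
    simp [WeierstrassCurve.baseChange, WeierstrassCurve.map_c₄]
  have h6 : ((⟨0, -1, 0, 0, -4⟩ : WeierstrassCurve ℚ).baseChange ℂ).c₆ = (((⟨0, -1, 0, 0, -4⟩ : WeierstrassCurve ℚ).c₆ : ℚ) : ℂ) := by
    simp [WeierstrassCurve.baseChange, WeierstrassCurve.map_c₆]
  have h4' : (⟨0, -1, 0, 0, -4⟩ : WeierstrassCurve ℚ).c₄ = 16 := by
    norm_num [WeierstrassCurve.c₄, WeierstrassCurve.b₂, WeierstrassCurve.b₄]
  have h6' : (⟨0, -1, 0, 0, -4⟩ : WeierstrassCurve ℚ).c₆ = 3520 := by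
    norm_num [WeierstrassCurve.c₆, WeierstrassCurve.b₂, WeierstrassCurve.b₄, WeierstrassCurve.b₆]
  rw [IsNeronLatticeOf, h4, h6, h4', h6']
  push_cast
  constructor
  · rintro ⟨ha, hb⟩; exact ⟨by rw [ha]; norm_num, by rw [hb]; norm_num⟩
  · rintro ⟨ha, hb⟩; exact ⟨by rw [ha]; norm_num, by rw [hb]; norm_num⟩

/-! ## §2 The Néron squeeze at level `56`: `|c| = 1` on `X₀(56)` -/

/-- **`|c| = 1` for every lattice-optimal `X₀(56)`-datum of every globally minimal elliptic `W/ℚ`** — UNCONDITIONAL (newform pinning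
`D.f = P − Q ∨ D.f = P + Q` by `NewformPinningFiftySix`; (S2)₅₆ₐ resp. (S2)₅₆_b by the `η`-identities; the Néron squeeze with `W₀ = 56a1`
resp. `56b1`).  A genus-`5` level of the C2 domain with TWO isogeny classes. [cite: CremonaAlgorithms1997, §2.10, Table 1 (56a1, 56b1)] -/
theorem abs_maninConstant_eq_one_fiftySix (W : WeierstrassCurve ℚ) [W.IsElliptic] [W.IsGloballyMinimal]
    (D : ModularParametrizationData W 56)
    (hopt : ∀ z ∈ D.L.lattice, ∃ w ∈ periodLattice D.f, z = D.c * w) :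
    |D.maninConstant| = 1 := by
  obtain ⟨P, hP⟩ := exists_cuspForm_P56
  obtain ⟨Q, hQ⟩ := exists_cuspForm_Q56
  rcases f_eq_fiftySix D P Q hP hQ with h | h
  · -- branch `56a`: `D.f = P − Q`
    haveI := isElliptic_fiftySixA1
    haveI := isGloballyMinimal_fiftySixA1
    have hφ : ⇑D.f = fun τ ↦ etaQuotient 56 (expFn [(2, -1), (4, 3), (14, 3), (28, -1)]) τ
        - etaQuotient 56 (expFn [(2, 3), (4, -1), (14, -1), (28, 3)]) τ := by
      rw [h, CuspForm.coe_sub, hP, hQ]; rfl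
    obtain ⟨L₁, h2, h3, hle⟩ := periodLatticeLe_fiftySixA D.f hφ
    exact NeronSqueeze.abs_maninConstant_eq_one_of_periodLattice_le (⟨0, 0, 0, 1, 2⟩ : WeierstrassCurve ℚ) L₁
      ((isNeronLatticeOf_fiftySixA1_iff L₁).mpr ⟨h2, h3⟩) W D hle hopt
  · -- branch `56b`: `D.f = P + Q`
    haveI := isElliptic_fiftySixB1
    haveI := isGloballyMinimal_fiftySixB1
    have hψ : ⇑D.f = fun τ ↦ etaQuotient 56 (expFn [(2, -1), (4, 3), (14, 3), (28, -1)]) τ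
        + etaQuotient 56 (expFn [(2, 3), (4, -1), (14, -1), (28, 3)]) τ := by
      rw [h, CuspForm.coe_add, hP, hQ]; rfl
    obtain ⟨L₁, h2, h3, hle⟩ := periodLatticeLe_fiftySixB D.f hψ
    exact NeronSqueeze.abs_maninConstant_eq_one_of_periodLattice_le (⟨0, -1, 0, 0, -4⟩ : WeierstrassCurve ℚ) L₁
      ((isNeronLatticeOf_fiftySixB1_iff L₁).mpr ⟨h2, h3⟩) W D hle hopt

/-- **C2 `ManinOddAtFour` at `N = 56` (`2² ∣ 56`): `2 ∤ c(D)`** for every lattice-optimal `X₀(56)`-datum — UNCONDITIONAL. [folklore] -/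
theorem not_two_dvd_maninConstant_fiftySix (W : WeierstrassCurve ℚ) [W.IsElliptic] [W.IsGloballyMinimal]
    (D : ModularParametrizationData W 56)
    (hopt : ∀ z ∈ D.L.lattice, ∃ w ∈ periodLattice D.f, z = D.c * w) :
    ¬ (2 : ℤ) ∣ D.maninConstant := by
  have h := abs_maninConstant_eq_one_fiftySix W D hopt
  intro h2
  have := Int.le_of_dvd (by rw [h]; norm_num) ((dvd_abs _ _).mpr h2)
  rw [h] at this
  norm_num at this

/-- **The C2 conclusion on the whole `X₀(56)`-domain**: `|c| = 1 ∧ 2 ∤ c` for every lattice-optimal `X₀(56)`-datum of every globally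
minimal elliptic curve over `ℚ` (and `2² ∣ 56`) — UNCONDITIONAL; BSD and C2 for general `N` are NOT proved by this. [folklore] -/
theorem maninOddAtFour_fiftySix :
    2 ^ 2 ∣ 56 ∧ ∀ (W : WeierstrassCurve ℚ) [W.IsElliptic] [W.IsGloballyMinimal] (D : ModularParametrizationData W 56),
      (∀ z ∈ D.L.lattice, ∃ w ∈ periodLattice D.f, z = D.c * w) → |D.maninConstant| = 1 ∧ ¬ (2 : ℤ) ∣ D.maninConstant :=
  ⟨two_sq_dvd_fiftySix, fun W _ _ D hopt ↦
    ⟨abs_maninConstant_eq_one_fiftySix W D hopt, not_two_dvd_maninConstant_fiftySix W D hopt⟩⟩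

end Summit.BirchSwinnertonDyer.BirchSwinnertonDyer.Theorems.ManinLocalTwoThree.ManinConstantFiftySix

end
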